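import Summits.FinalStateConjecture.FinalStateConjecture.Theorems.ZeroEnergyKerrOrBombStationaryLimitReductionRecutCoveringJunctionCore
import Summits.FinalStateConjecture.FinalStateConjecture.Theorems.ZeroEnergyKerrOrBombStationaryLimitReductionTimeEquivariantMaps
import Literature.Geometry.Lorentzian.KerrLeafEnergyComparison
import Literature.Geometry.Lorentzian.KerrWaveEnergy
import HarnessLib

/-!
# Route ZeroEnergyKerrOrBomb · crux `FinalStateFromKerrOrBomb` (stmt-FinalStateConjecture-17839), line
# `SketchIdeator1` — stub `stub_recutJunctionCoreOriented`, wave 4: inside the junction core the time scale of the Kerr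
# identification is `c = 1` (Kerr–Schild time and adapted chart time agree up to the bounded tilt)

Helper file (`--supports stmt-FinalStateConjecture-17839`; registered helper `recutJunction_c_eq_one`) of the lead's wave-4
stub worker W15 (2026-08-17); companion of `…RecutPastBoundaryFlat.lean` (p143586) and `…RecutPastBoundaryOverlap.lean`.

Two binders of the oriented junction core — `ChartIsAsymptoticallyCartesian (d.adapted i)` (clause (1): the chart
components tend to `η` as the adapted radius `→ ∞`) and `IsKerrChartedWith (d.hole i) (d.adapted i) M a c r₀ Θ` (its
isometry clause `A.bilin (Θ x)(dΘ v, dΘ w) = g_{M,a}(x)(v, w)`, `T`-equivariance `dΘ e₀ = c e₀`, and its far control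
`|A.radius (Θ u) − r(u)| ≤ L` on `{r ≥ r₊ + 1}`) — already force `c = 1`:
`c² · A.bilin(Θ u)(e₀, e₀) = g_{M,a}(u)(e₀, e₀) = −1 + 2H(u)` with `0 ≤ 2H(u) ≤ 2M / r(u)`, and
`|A.bilin(Θ u)(e₀, e₀) + 1| ≤ ‖A.bilin(Θ u) − η‖ ≤ ε` once `A.radius (Θ u) ≥ r(u) − L ≥ R₀(ε)`; letting `r(u) → ∞` along
`u = (0, ρ, 0, 0)` gives `|c² − 1| ≤ δ` for every `δ > 0`. So in the junction the recut Kerr–Schild time `t*` and the old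
chart time differ by the bounded tilt only (no linear drift), which is what bounds the comoving flow durations in the
W15 proof plan (`work/stubs/W15-report.md`); the neighbour F4 (`KerrAsymptoticRigidity`, which DERIVES the far control) is
neither used nor restated — here the far control is a hypothesis (it is a clause of `IsKerrChartedWith`).

Elementary; no named fact. References: Chruściel–Costa arXiv:0806.0016, §2.1; O'Neill 1983, Ch. 9, p. 236.
-/

set_option linter.dupNamespace false

noncomputable section

open scoped Manifold ContDiff Topology ENNReal
open Set Filter Function Literature.Geometry.Lorentzian

namespace Summit.FinalStateConjecture.FinalStateConjecture.Theorems.SymplecticDualOfTheBomb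

open Summit.FinalStateConjecture.FinalStateConjecture.Theorems.OneLockedExplosion

/-- Far points of the Kerr–Schild chart: for every `ρ₀` there is a point `u` of `E4` with Kerr–Schild radius `≥ ρ₀`
(`u = (0, y)` with `‖y‖ = |ρ₀| + |a|`, and `r² ≥ ‖y‖² − a²`). [folklore] -/
private theorem exists_radius_ge_w4 (a ρ₀ : ℝ) : ∃ u : E4, ρ₀ ≤ Kerr.radius a u := by
  set y : E3 := EuclideanSpace.single 0 (|ρ₀| + |a|) with hy
  have hny : ‖y‖ = |ρ₀| + |a| := by
    rw [hy, EuclideanSpace.single, PiLp.norm_single, Real.norm_eq_abs, abs_of_nonneg (by positivity)]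
  refine ⟨E4.ofTimeSpace 0 y, ?_⟩
  have h1 := Kerr.spatialNorm_sq_sub_sq_le_radius_sq a (E4.ofTimeSpace 0 y)
  rw [E4.spatialNorm_ofTimeSpace, hny] at h1
  have h2 : ρ₀ ^ 2 ≤ Kerr.radius a (E4.ofTimeSpace 0 y) ^ 2 := by
    nlinarith [abs_nonneg ρ₀, abs_nonneg a, sq_abs ρ₀, sq_abs a]
  nlinarith [Kerr.radius_nonneg a (E4.ofTimeSpace 0 y), le_abs_self ρ₀, abs_nonneg ρ₀]

/-- **Registered helper `recutJunction_c_eq_one` (stub `stub_recutJunctionCoreOriented`, wave 4).** For an adapted chart `A`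
which is asymptotically Cartesian (clause (1) of `ChartIsAsymptoticallyCartesian`: `‖A.bilin − η‖ ≤ ε` beyond adapted radius
`R₀(ε)`) and a Kerr identification `IsKerrChartedWith 𝓑 A M a c r₀ Θ` (isometry clause, `T`-equivariance with time scale
`c > 0`, far control `|A.radius (Θ u) − r(u)| ≤ L`), the time scale is `c = 1`:
`c² A.bilin(Θ u)(e₀, e₀) = −1 + 2H(u) → −1` while `A.bilin(Θ u)(e₀, e₀) → η(e₀, e₀) = −1` as `r(u) → ∞`.
Chruściel–Costa arXiv:0806.0016, §2.1. [folklore] -/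
theorem recutJunction_c_eq_one : ∀ (𝓑 : StationaryAFBlackHole.{0}) (A : 𝓑.AdaptedChart) (M a c r₀ : ℝ) (Θ : E4 → E4), ChartIsAsymptoticallyCartesian A → IsKerrChartedWith 𝓑 A M a c r₀ Θ → c = 1 := by
  intro 𝓑 A M a c r₀ Θ hcart hW
  obtain ⟨hcart1, -, -, -⟩ := hcart
  obtain ⟨hsub, hc, -, hr₀, hΘs, -, hΘm, hΘe, hiso, -, L, hL⟩ := hW
  have hrp : 0 < Kerr.rPlus M a := hsub.pos.trans_le (le_add_of_nonneg_right (Real.sqrt_nonneg _))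
  -- `|c² − 1| ≤ δ` for every `δ > 0`
  have key : ∀ δ : ℝ, 0 < δ → |c ^ 2 - 1| ≤ δ := by
    intro δ hδ
    set ε : ℝ := δ / (2 * c ^ 2) with hε_def
    have hε : 0 < ε := by positivity
    obtain ⟨R₀, hR₀⟩ := hcart1 ε hε
    -- a far exterior point `u`
    obtain ⟨u, hu⟩ := exists_radius_ge_w4 a (max (Kerr.rPlus M a + 1) (max (R₀ + L) (4 * M / δ)))
    have hu1 : Kerr.rPlus M a + 1 ≤ Kerr.radius a u := (le_max_left _ _).trans hu
    have hu2 : R₀ + L ≤ Kerr.radius a u := ((le_max_left _ _).trans (le_max_right _ _)).trans hu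
    have hu3 : 4 * M / δ ≤ Kerr.radius a u := ((le_max_right _ _).trans (le_max_right _ _)).trans hu
    have hrad : 0 < Kerr.radius a u := by linarith
    have hux : u ∈ (Kerr.exterior M a : Set E4) := Kerr.mem_exterior.2 (by
      rw [max_eq_left hrp.le]; linarith)
    have hureg : u ∈ (Kerr.region a r₀ : Set E4) :=
      Kerr.mem_region.2 ((max_le_max hr₀.le le_rfl).trans_lt (Kerr.mem_exterior.1 hux))
    have hΘu : Θ u ∈ A.domain := hΘm hureg
    -- the isometry clause on `e₀`: `A.bilin (Θ u) (c e₀) (c e₀) = -1 + 2H(u)`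
    have hdΘ : fderiv ℝ Θ u (E4.basisVector 0) = c • E4.basisVector 0 :=
      fderiv_apply_basisVector_zero_of_contDiffOn (Kerr.region a r₀).isOpen (by simp) hΘs hΘe hureg
    have hval : A.bilin (Θ u) (c • E4.basisVector 0) (c • E4.basisVector 0) = -1 + 2 * Kerr.scalarH M a u := by
      rw [← hdΘ, hiso u hux, Kerr.bilin_basisVector_zero_basisVector_zero]
    have hval' : A.bilin (Θ u) (c • E4.basisVector 0) (c • E4.basisVector 0) =
        c ^ 2 * A.bilin (Θ u) (E4.basisVector 0) (E4.basisVector 0) := by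
      rw [map_smul, map_smul, smul_apply, smul_eq_mul, smul_eq_mul]; ring
    -- asymptotic Cartesian-ness at `Θ u`: `|A.bilin (Θ u)(e₀, e₀) + 1| ≤ ε`
    have hAR : R₀ ≤ A.radius (Θ u) := by
      have h := (abs_le.1 (hL u hux hu1).2.1).1
      linarith
    have hnorm : ‖A.bilin (Θ u) - Minkowski.bilin‖ ≤ ε := hR₀ ⟨Θ u, hΘu⟩ hAR
    have he₀ : ‖E4.basisVector 0‖ = 1 := by simp [E4.basisVector]
    have hdiff : |A.bilin (Θ u) (E4.basisVector 0) (E4.basisVector 0) + 1| ≤ ε := by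
      have h1 : |(A.bilin (Θ u) - Minkowski.bilin) (E4.basisVector 0) (E4.basisVector 0)| ≤
          ‖A.bilin (Θ u) - Minkowski.bilin‖ * ‖E4.basisVector 0‖ * ‖E4.basisVector 0‖ := by
        rw [← Real.norm_eq_abs]; exact (A.bilin (Θ u) - Minkowski.bilin).le_opNorm₂ _ _
      rw [he₀, mul_one, mul_one] at h1
      have h2 : (A.bilin (Θ u) - Minkowski.bilin) (E4.basisVector 0) (E4.basisVector 0) =
          A.bilin (Θ u) (E4.basisVector 0) (E4.basisVector 0) + 1 := by
        rw [sub_apply, sub_apply, Minkowski.bilin_basisVector_zero]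
        ring
      rw [h2] at h1
      exact h1.trans hnorm
    -- `0 ≤ 2H(u) ≤ 2M/r(u) ≤ δ/2`
    have hH0 : 0 ≤ Kerr.scalarH M a u := Kerr.scalarH_nonneg hsub.pos.le a u
    have hH1 : Kerr.scalarH M a u ≤ M / Kerr.radius a u := Kerr.scalarH_le_div hsub.pos.le a hrad
    have hH2 : M / Kerr.radius a u ≤ δ / 4 := by
      rw [div_le_iff₀ hrad]
      have h := (div_le_iff₀ hδ).1 hu3
      nlinarith
    -- combine: `c² (A₀₀) = -1 + 2H`, `|A₀₀ + 1| ≤ ε`, `ε c² = δ/2`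
    have hεc : ε * c ^ 2 = δ / 2 := by
      rw [hε_def]; field_simp
    set A₀ : ℝ := A.bilin (Θ u) (E4.basisVector 0) (E4.basisVector 0) with hA₀
    have hmain : c ^ 2 * A₀ = -1 + 2 * Kerr.scalarH M a u := by rw [← hval', hval]
    have hb := abs_le.1 hdiff
    have hc2 : 0 ≤ c ^ 2 := sq_nonneg c
    rw [abs_le]
    constructor
    · nlinarith [mul_le_mul_of_nonneg_left hb.2 hc2]
    · nlinarith [mul_le_mul_of_nonneg_left hb.1 hc2]
  have hc2 : c ^ 2 = 1 := by
    refine eq_of_forall_dist_le fun δ hδ ↦ ?_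
    rw [Real.dist_eq]
    exact key δ hδ
  nlinarith [hc2, hc]

end Summit.FinalStateConjecture.FinalStateConjecture.Theorems.SymplecticDualOfTheBomb

end
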